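import Literature.NumberTheory.Automorphic.BrandtDataTransport
import HarnessLib

/-!
# Locally conjugate orders are connected by an invertible ideal; their Brandt data agree
# (Vignéras, LNM 800, Ch. I §4 (ordres liés), Ch. III §5 Prop. 5.1 (gluing) and §5 B)

Topic `NumberTheory/Automorphic`; theorems only (no definition, no named fact, no instance).
Let `O, O'` be `ℤ`-orders of a division quaternion algebra `B` over `ℚ` which are *locally
conjugate*: for every prime `q` there is `x_q ∈ Bˣ` with `O'_(q) = x_q O_(q) x_q⁻¹`
(localisations inside `B`, `LatticeLocalGlobal.lean`). Gluing the local lattices `x_q O_(q)`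
(Vignéras III §5 Prop. 5.1; the tree's one-prime-at-a-time `exists_localAt_eq_and_forall_localAt_eq`,
iterated over the finitely many primes where `O` and `O'` differ) produces a lattice `I` with
`I_(q) = x_q O_(q)` at those primes and `I_(q) = O_(q)` elsewhere: an invertible right `O`-ideal
(Kaplansky's criterion) whose left order is `O'` — a *connecting ideal* ("`O` et `O'` sont liés").
With `BrandtDataTransport.lean` this gives the global half of the independence of the Brandt
module from the choice of the order in its genus:

* `exists_pow_smul_mem_localAt` — commensurability of full lattices in `p`-power form;
* `exists_glue_units_smul` — for a finite set `S` of primes and units `x_q`, a full lattice `I`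
  with `I_(q) = x_q O_(q)` (`q ∈ S`) and `I_(q) = O_(q)` (`q ∉ S`);
* `exists_isInvertibleRightIdeal_leftOrderOf_eq` — **locally conjugate orders are connected**:
  an invertible right `O`-ideal `I` with `O_ℓ(I) = O'`;
* `BrandtData.ofOrder_iso_of_locallyConjugate` — **their Brandt data are isomorphic**:
  `∃ e : Cls O ≃ Cls O', w' (e i) = w i ∧ B'(n) (e i) (e j) = B(n) i j`.

## References

* M.-F. Vignéras, *Arithmétique des algèbres de quaternions*, LNM 800 (1980), Ch. I §4,
  Ch. III §5 Prop. 5.1 and B [VignerasLNM800].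
* J. Voight, *Quaternion Algebras*, GTM 288 (2021), Thm. 9.4.9, Lemma 17.4.6 [Voight2021].
-/

noncomputable section

open scoped Pointwise

universe u

namespace Literature.NumberTheory.Automorphic

variable {B : Type u} [Ring B] [Algebra ℚ B] [IsQuaternionAlgebra ℚ B]

/-! ### Commensurability in `p`-power form -/

omit [Algebra ℚ B] [IsQuaternionAlgebra ℚ B] in
/-- For a finitely generated `L` and a full lattice `M` there is `r` with `p^r L ⊆ M_(p)`
(`n L ⊆ M` for some `n ≠ 0`; strip the prime-to-`p` part of `n`). [folklore] -/
theorem exists_pow_smul_mem_localAt {p : ℕ} (hp : p.Prime) {L M : Submodule ℤ B} (hL : L.FG)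
    (hM : IsFullLattice B M) : ∃ r : ℕ, ∀ x ∈ L, ((p : ℤ) ^ r) • x ∈ localAt p M := by
  obtain ⟨n, hn, hnL⟩ := exists_smul_mem_of_fg hM hL
  set N : ℕ := n.natAbs with hN
  have hN0 : N ≠ 0 := Int.natAbs_ne_zero.mpr hn
  refine ⟨N.factorization p, fun x hx => ?_⟩
  set m : ℕ := N / p ^ N.factorization p
  have hm0 : m ≠ 0 := (Nat.div_pos (Nat.ordProj_le p hN0) (Nat.ordProj_pos N p)).ne'
  have hmcop : m.Coprime p := (Nat.coprime_ordCompl hp hN0).symm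
  refine mem_localAt_of_smul_mem hm0 hmcop ?_
  rw [smul_smul, ← Nat.cast_pow, ← Nat.cast_mul, Nat.mul_comm, Nat.ordProj_mul_ordCompl_eq_self]
  -- `N • x = ± n • x ∈ M`
  rcases Int.natAbs_eq n with h | h
  · rw [hN, ← h]; exact hnL x hx
  · rw [hN, show ((n.natAbs : ℕ) : ℤ) = -n by omega, neg_smul]
    exact M.neg_mem (hnL x hx)

omit [IsQuaternionAlgebra ℚ B] in
/-- A lattice squeezed `p^r L ⊆ M`, `p^r M ⊆ L` around a full lattice `L` is a full lattice. [folklore] -/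
theorem isFullLattice_of_pow_smul {p : ℕ} (hp : p.Prime) {L M : Submodule ℤ B} (hL : IsFullLattice B L)
    (r : ℕ) (hLM : ∀ x ∈ L, ((p : ℤ) ^ r) • x ∈ M) (hML : ∀ x ∈ M, ((p : ℤ) ^ r) • x ∈ L) :
    IsFullLattice B M := by
  haveI : IsAddTorsionFree B := isAddTorsionFree_of_charZero_module ℚ B
  have hpr : ((p : ℤ) ^ r) ≠ 0 := pow_ne_zero r (by exact_mod_cast hp.ne_zero)
  refine ⟨?_, fun d => ?_⟩
  · -- `M ⊆ (p^r)⁻¹ L`, the image of `L` under the `ℚ`-linear automorphism `y ↦ p^{-r} y`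
    let f : B →ₗ[ℤ] B := ((LinearMap.lsmul ℚ B ((p : ℚ) ^ r)⁻¹)).restrictScalars ℤ
    refine Submodule.FG.of_le (hL.1.map f) fun x hx => ?_
    refine ⟨((p : ℤ) ^ r) • x, hML x hx, ?_⟩
    simp only [f, LinearMap.coe_restrictScalars, LinearMap.lsmul_apply]
    rw [← Int.cast_smul_eq_zsmul ℚ, smul_smul]
    push_cast
    rw [inv_mul_cancel₀ (pow_ne_zero r (by exact_mod_cast hp.ne_zero)), one_smul]
  · obtain ⟨n, hn, hnd⟩ := hL.2 d
    exact ⟨(p : ℤ) ^ r * n, mul_ne_zero hpr hn, by rw [mul_smul]; exact hLM _ hnd⟩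

/-! ### Gluing the local lattices `x_q O_(q)` -/

omit [IsQuaternionAlgebra ℚ B] in
/-- **Gluing** (Vignéras III §5 Prop. 5.1, finitely many primes at a time): for a `ℤ`-order
`O`, a finite set `S` of primes and units `x_q`, there is a full lattice `I` with
`I_(q) = x_q O_(q)` for `q ∈ S` and `I_(q) = O_(q)` for primes `q ∉ S`. [cite: VignerasLNM800, Ch. III §5 Prop. 5.1] -/
theorem exists_glue_units_smul {O : Submodule ℤ B} (hO : IsZOrder O) (x : ℕ → Bˣ) (S : Finset ℕ)
    (hS : ∀ q ∈ S, q.Prime) :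
    ∃ I : Submodule ℤ B, IsFullLattice B I ∧ (∀ q ∈ S, localAt q I = x q • localAt q O) ∧
      ∀ q : ℕ, q.Prime → q ∉ S → localAt q I = localAt q O := by
  classical
  induction S using Finset.induction_on with
  | empty => exact ⟨O, hO.isFullLattice, fun q hq => absurd hq (Finset.notMem_empty q), fun q _ _ => rfl⟩
  | insert p S hpS ih =>
    obtain ⟨L, hLfull, hLS, hLout⟩ := ih fun q hq => hS q (Finset.mem_insert_of_mem hq)
    have hp : p.Prime := hS p (Finset.mem_insert_self p S)
    haveI : Fact p.Prime := ⟨hp⟩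
    -- the target local lattice at `p`
    set N : Submodule ℤ B := x p • localAt p O with hN
    have hNloc : localAt p N = N := by rw [hN, ← localAt_units_smul, localAt_localAt]
    have hxOfull : IsFullLattice B (x p • O) := hO.isFullLattice.units_smul (x p)
    -- commensurability `p^r L ⊆ N`, `p^r N ⊆ L_(p)`
    obtain ⟨r₁, hr₁⟩ := exists_pow_smul_mem_localAt hp hLfull.1 hxOfull
    obtain ⟨r₂, hr₂⟩ := exists_pow_smul_mem_localAt hp hxOfull.1 hLfull
    have hLN : ∀ y ∈ L, ((p : ℤ) ^ (r₁ + r₂)) • y ∈ N := fun y hy => by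
      rw [pow_add, mul_comm, mul_smul, hN, ← localAt_units_smul]
      exact Submodule.smul_mem _ _ (hr₁ y hy)
    have hNL : ∀ y ∈ N, ((p : ℤ) ^ (r₁ + r₂)) • y ∈ localAt p L := fun y hy => by
      rw [hN, ← localAt_units_smul] at hy
      obtain ⟨m, hm0, hm, hmy⟩ := hy
      rw [pow_add, mul_smul]
      refine Submodule.smul_mem _ _ ?_
      have h := hr₂ _ hmy
      rw [smul_comm] at h
      have h' := mem_localAt_of_smul_mem hm0 hm h
      rwa [localAt_localAt] at h'
    obtain ⟨M, hMp, hMq, hLM, hML⟩ :=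
      exists_localAt_eq_and_forall_localAt_eq hp L N hNloc (r₁ + r₂) hLN hNL
    refine ⟨M, isFullLattice_of_pow_smul hp hLfull _ hLM hML, fun q hq => ?_, fun q hq hqS => ?_⟩
    · rcases Finset.mem_insert.mp hq with rfl | hq'
      · exact hMp
      · have hqp : q ≠ p := fun h => hpS (h ▸ hq')
        rw [hMq q (hS q hq) hqp, hLS q hq']
    · have hqp : q ≠ p := fun h => hqS (h ▸ Finset.mem_insert_self p S)
      rw [hMq q hq hqp, hLout q hq fun h => hqS (Finset.mem_insert_of_mem h)]

/-! ### Connecting ideals and the Brandt data -/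

omit [IsQuaternionAlgebra ℚ B] in
/-- **Locally conjugate orders are connected by an invertible ideal** (Vignéras I §4: `O'` is
the left order of a right `O`-ideal iff `O` and `O'` are locally conjugate). If `O, O'` are
`ℤ`-orders of a division quaternion algebra over `ℚ` and `O'_(q) = x_q O_(q) x_q⁻¹` for every
prime `q`, with `x_q ∈ Bˣ` and `O'_(q) = O_(q)` outside a finite set of primes, then there is an
invertible right `O`-ideal `I` with `O_ℓ(I) = O'` (any quaternion algebra over `ℚ`). [cite: VignerasLNM800, Ch. I §4 (ordres liés) and Ch. III §5 Prop. 5.1] -/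
theorem exists_isInvertibleRightIdeal_leftOrderOf_eq
    {O O' : Submodule ℤ B} (hO : IsZOrder O) (x : ℕ → Bˣ) (S : Finset ℕ)
    (hS : ∀ q ∈ S, q.Prime)
    (hconj : ∀ q ∈ S, localAt q O' = x q • (MulOpposite.op (((x q)⁻¹ : Bˣ) : B) • localAt q O))
    (heq : ∀ q : ℕ, q.Prime → q ∉ S → localAt q O' = localAt q O) :
    ∃ I : Submodule ℤ B, IsInvertibleRightIdeal O I ∧ leftOrderOf I = O' := by
  obtain ⟨I, hIfull, hIS, hIout⟩ := exists_glue_units_smul hO x S hS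
  have hI : IsInvertibleRightIdeal O I := by
    refine IsInvertibleRightIdeal.of_forall_localAt_eq_units_smul hO hIfull fun q hq => ?_
    by_cases hqS : q ∈ S
    · exact ⟨x q, hIS q hqS⟩
    · exact ⟨1, by rw [one_smul, hIout q hq hqS]⟩
  refine ⟨I, hI, eq_iff_forall_prime_localAt_eq.mpr fun q hq => ?_⟩
  rw [← leftOrderOf_localAt q hIfull.1]
  by_cases hqS : q ∈ S
  · rw [hIS q hqS, leftOrderOf_units_smul, hO.leftOrderOf_localAt_eq, hconj q hqS]
  · rw [hIout q hq hqS, hO.leftOrderOf_localAt_eq, heq q hq hqS]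

/-- **The Brandt data of locally conjugate orders are isomorphic** (Vignéras III §5 B–C;
Eichler 1973 II §6: the Brandt matrices of an order depend only on its genus): under the
hypotheses of `exists_isInvertibleRightIdeal_leftOrderOf_eq` there is `e : Cls O ≃ Cls O'` with
`w'_{e i} = w_i` and `B'(n)_{e i, e j} = B(n)_{i j}`. [cite: VignerasLNM800, Ch. III §5 B] -/
theorem BrandtData.ofOrder_iso_of_locallyConjugate (hdiv : ∀ x : B, x ≠ 0 → IsUnit x)
    {O O' : Submodule ℤ B} (hO : IsZOrder O) (hO' : IsZOrder O') (x : ℕ → Bˣ) (S : Finset ℕ)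
    (hS : ∀ q ∈ S, q.Prime)
    (hconj : ∀ q ∈ S, localAt q O' = x q • (MulOpposite.op (((x q)⁻¹ : Bˣ) : B) • localAt q O))
    (heq : ∀ q : ℕ, q.Prime → q ∉ S → localAt q O' = localAt q O) :
    ∃ e : RightIdealClass O ≃ RightIdealClass O',
      (∀ i, (BrandtData.ofOrder O' hO').w (e i) = (BrandtData.ofOrder O hO).w i) ∧
      ∀ n i j, (BrandtData.ofOrder O' hO').T n (e i) (e j) = (BrandtData.ofOrder O hO).T n i j := by
  obtain ⟨I, hI, hO'I⟩ := exists_isInvertibleRightIdeal_leftOrderOf_eq hO x S hS hconj heq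
  subst hO'I
  obtain ⟨e, -, hw, hT⟩ := BrandtData.ofOrder_transport hdiv hO hI
  exact ⟨e, hw, hT⟩

end Literature.NumberTheory.Automorphic

end
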